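import Summits.AtomisticToContinuum.HydrodynamicLimit.Theses.OneFlightGossipEngine
import Literature.Analysis.FluidPDE.HardSphereAlexander
import Literature.MathematicalPhysics.KineticTheory.HardSphereEulerProofs

/-!
# Disproof of `OneFlightLayeredChaos` (crux stmt-AtomisticToContinuum-14535) — findings

Standing adversary file (refuter `cdisprove`; cycle 1 = gen 1, 2026-08-16 05:00–11:15Z; cycle 2 = gen 2,
2026-08-16 18:40Z–, §2b and §8 are new, §6 is revised a third time). VERDICT SO FAR: **no kill**; the
statement resists every cheap attack, the genuine falsity mechanisms found are all *polynomially
small in `σ`* (inside the claimed rate `∃ p > 0`), and the one `σ`-FREE candidate (two-snapshot rigidity on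
the long-gap event) is, on the gen-2 analysis of §8, an entropy–likelihood competition that the ENTROPY of
local re-pairings wins at small `σ` — the disprover now leans to "true, with sharp exponent `p = 3`".
Index of this file:

* §0 `Body`, `defect`, `oneFlightLayeredChaos_iff`, `body_iff` — the crux unfolded into a named
  per-`(a₀, θ₀)` body and a named defect functional (both `Iff.rfl`), so that the lemmas below are
  literally about the route decl.
* §1 NON-VACUITY / NON-TRIVIALITY (all proved):
  `nonempty_flow` — the `∀ Φ : HardSphereFlow …` ranges over an INHABITED type for `0 < σ < 1/2`
  (Alexander's theorem is in the tree: `HardSphereFlow.nonempty_torus_holds`), so no refutation or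
  proof can exploit emptiness; `isProbabilityMeasure_P` — the law `P` is a probability measure
  (`σ ≤ 1/2`); `u_nonneg`, `u_le_one` — the centring `u(B) ∈ [0,1]`;
  `defect_le_measure`, `defect_le_one` — the TRIVIAL REGIME: `|P(W∩A∩E) − u·P(W∩E)| ≤ P(W∩E) ≤ 1`
  always, so the crux inequality is void exactly when `C σ^p ≥ 1` (`tail_of_one_le`); since
  `C, p` are fixed BEFORE `σ → 0` it is not void (the (M2) loophole of the predecessor 9688 is closed),
  and it is not void through `P(W)` either: `∀ τ` lets `P(W) → 1` (informal, stationarity; `τ` is in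
  interparticle-spacing time units, `w/ℓ`-time `= √2 π σ² τ √θ₀`); `defect_zero_particles` — the degenerate
  instance `N = 0` (one sphere) has `W = ∅` and defect `0` (small-`N` content starts at `N = 1`, excluded by `N₀`);
  `defect_empty`, `defect_univ` — `B = ∅` and `B ⊇ S²` give defect `0` identically (content sits at e.g. half-spaces).
* §2 HYPOTHESIS MUTATION, formal part (proved): the activity `a₀` DROPS OUT —
  `localGibbsLaw_const_activity` (canonical normalisation cancels `a₀^{N+1}`), `localGibbsLaw_zero_activity`
  (`a₀ = 0` gives the zero measure), hence `body_iff_body_one`, `body_zero` and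
  `oneFlightLayeredChaos_iff_activity_free : OneFlightLayeredChaos ↔ ∀ a₀ θ₀, 0 < θ₀ → Body a₀ θ₀`:
  the hypothesis `0 < a₀` is decoration and provers may take `a₀ = 1`. (`θ₀` also drops out, by the
  velocity/time scaling `v ↦ √θ₀ v`, `t ↦ t/√θ₀`, absorbed by `∀ τ`; NOT formalised — it needs a
  rescaling map `HardSphereFlow … ≃ HardSphereFlow …`, absent from the tree.)
* §2b (gen 2, all proved) MESH MONOTONICITY — the `∃ ρ` freedom is a factor-2 window: nested meshes give
  nested pasts (`pastSigma_natCast_mul_le : 𝒢_{mρ} ≤ 𝒢_ρ`, `m : ℕ`), so `tail_natCast_mul : Tail ρ → Tail (m ρ)`,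
  `body_iff_topOctave` / `oneFlightLayeredChaos_iff_topOctave` (WLOG `1/2 < ρ√2πσ² ≤ 1`: cells of ½–1 mean free
  path), `tail_zero_of_tail` (the velocity-only past is implied by every mesh). Non-nested meshes are
  incomparable, so a fixed-mesh refutation at `ρ⋆` (line `Sketch`) formally covers only `ρ⋆/ℕ`. Landed copy:
  `Theorems/OneFlightLayeredChaos/Negative/MeshMonotone.lean`.
* §3 LOAD-BEARING ANALYSIS, dynamical part (near-misses, `sorry` with the obstruction documented):
  `not_bodyUniformN` — `N₀` chosen BEFORE `σ` is FALSE (bounded `N`, `σ → 0` is the periodic-Lorentz /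
  Boltzmann–Grad-on-𝕋³ regime; at `N = 1` the Marklof–Strömbergsson kernel is non-uniform given the past);
  `not_tailAllEvents` — dropping `E ∈ 𝒢` (all events) is FALSE with `E = A` (the kick is not a.s. constant);
  `not_tailEssSup` — the RELATIVE (ess-sup) conditional form `≤ C σ^p · P(W ∩ E)` is FALSE by 3-ring events.
* §4 TIGHTNESS: `not_body_exponent_gt_three` (near-miss, `sorry`): no proof can deliver `p > 3`; two
  independent floors `≍ σ³` uniformly in `N → ∞`: (i) cell-gradient leak `≍ ε/r = σ/ρ ≥ √2πσ³` on
  `O(1)`-mass events (forced by `ρ ≤ (√2πσ²)⁻¹`; two-sided thin-box pinning is `(ε/r)²`, subdominant),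
  (ii) 3-ring events of mass `≍ ε/ℓ ≍ σ³` with `O(1)` conditional bias.
  The card's heuristic `p = 3/2` is consistent with the floor. ADVICE TO PROVERS: take `ρ` MAXIMAL
  (`r ≍ ℓ`): the `L¹(𝒢)` defect is monotone in information, the card's `r/ℓ` term is a proof artefact of
  freezing the environment over a cell, not a floor of the statement.
* §5 `-- Targets`: line `Sketch` (PICKED 10:31Z, lead cycle 2) reshaped `stub_body_one` (= `Body 1 θ₀`, i.e. the crux via
  `oneFlightLayeredChaos_iff_one` of THIS file) into record-geometry / preVel-bookkeeping / 3-D isotropy (closable, not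
  attackable) ∘ `stub_core` (conditional flux law of the impact vector given `𝒢`): `stub_core` is attackable only through
  §6's rigid-regime test; no stub of the line is false for cheap reasons. No `stuck_stubs` handed over yet.
* §6 (REVISED 2026-08-16 10:50Z — supersedes the cycle-1 text "no `O(1)`-mass pinning exists, information budget
  `3(N+1)+2·#coll < 6(N+1)`", which was WRONG: given the snapshot at `s₋` the unknowns are only the `3M` sub-cell
  position offsets of the `M` inter-snapshot colliders, and the exact velocities at `s₊` are `3M − 4` smooth functions
  of them; see the ideator memos `TwoSnapshotRigidity*.md`, `IdeatorOnePinningNotes.md` and the lead's `NOTES.md` §B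
  in this directory.) THE LIVE DICHOTOMY. Let `d := Δs/t_mfp` (gap between the two flight starts in mean free times;
  its law is `σ`-FREE). Maxwell/pebble count for a body `S` of the inter-snapshot collision graph with `e` collisions:
  rank `D(v(s₊))|_S = min(2e, 3|S| − 4)` (final velocities see positions only through the `2`-dof normals; momentum +
  energy per component are identities). FLOPPY regime (`d ≲ 3`): free clocks ⇒ `b` is an affine image of a Lebesgue
  law of width `≫ ε` ⇒ a.c., `ε`-smooth; only ring-type exceptions (`≍ σ³|log σ|`) — this is §4's floor `p ≤ 3`.
  RIGID regime (`d ≳ 3–4`, `σ`-free mass `≍ e^{-d}`): NO free clocks — the exact two-snapshot fibre through the truth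
  is a point mod the 4 symmetry directions (translations + time shift, both invisible to `b`), so `b` IS PINNED
  LOCALLY, per branch (ideator kit rank tests j013073/165/375, posterior widths j013358/667/518). Whether the crux
  survives there depends on the GLOBAL structure of the fibre: it is a weighted dust of preimage branches
  (area formula: multiplicity `≍ (r/ε)^{3|S|}(ℓ/ε)^{Σ depths}`, weights `1/J`), and
      crux on {d ≳ 3}  ⟺  the `1/J`-weighted branch centres `Π_⊥ c_β` are equidistributed at scale `ε` on the `2ε`-disc
  (lead NOTES §B4: then the hemisphere bump averages out EXACTLY; otherwise a `σ`-free bias `≍ e^{-3} ≈ 0.05` on a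
  `σ`-free event ⇒ `refuted-substantive`). Neither direction is in print; the lead's 2-D Lorentz toy (one particle, one
  final angle) shows `≥ 10⁴` branches with spread `b`, but is structurally WEAKER than the N-body fibre: in the gas every
  collision leaves two matched records and all PRE-velocities are exact, so (adversary caveat, new) every LEAF of the
  collision forest — a particle with one inter-snapshot collision whose partner's pre-velocity is known — over-determines
  its collision (`ω ∥ Δv`, plus the scalar consistency `|Δv| = −(v_p − v_q)·ω̂` among DATA) and generically EXCLUDES every
  rewiring through it; branch graphs must moreover have components that are unions of the true components (per-component
  conservation is an identity of the data). So the admissible dust is "local rewirings of the rigid core with the leaf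
  structure frozen", far sparser than the Lorentz count suggests — multiplicity may still be astronomical (Krylov–Sinai
  folding inside a FIXED itinerary already gives many roots of the square realizability system), but this is now a
  concrete, computable question. DECISIVE TEST (cycle 2, kit): small rigid cluster (`M = 5–8`, `K ≈ 1.5M` prescribed
  collisions, `ℓ/ε = 10–20`), unknowns (offsets, normals, clocks), SMOOTH square system {contact equations, final
  velocities = data} per prescribed itinerary (no piece boundaries), multi-start Newton over itineraries = truth's order
  permutations and local rewirings; filter admissible roots (cells, clock order, incoming normals, no unintended
  encounter on the realised trajectory); output: number of admissible branches vs restarts (saturation ⇒ pinned ⇒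
  compute the `𝒢`-measurable hemisphere predictor and its advantage; no saturation + flat `Π_⊥c_β` histogram ⇒ supports
  the crux's mixing stub). Until then: NOT refuted, and NOT supported beyond the floppy regime.
  STATUS (gen 2, 18:40Z; supersedes the 11:15Z status "small-scale evidence leans to GLOBAL pinning, pending
  j016931"): j016931 finished (13:12Z, rc 0) but its logs are not readable from this seat; it is MOOT — the lead's
  coarea + Markov lemma (SketchKinematic.md, COAREA-MULTIPLICITY.md, kit j017669: at `M = 12`, `ℓ/ε = 5`, gap
  `d = 4–5`, ≥ 10^{30}–10^{45} admissible fibre orbits in the `L/2`-cell box for the median rigid sample) is a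
  THEOREM-grade lower bound (`J ≥ Λ` off small prior mass + bounded image ⇒ `P(#roots < m) ≤ η + m·π_max·H^k(F(U))/Λ`),
  so a multi-start Newton "only the truth found" is a search failure, not pinning. The dichotomy is re-analysed
  in §8: it is an ENTROPY (of re-pairings, `≍ 2 log(ℓ/ε)` nats per slot) versus LIKELIHOOD (`O(1)` nats per
  re-paired particle) competition, won by entropy as `σ → 0`; the disprover's kill direction is unpromising and no
  further compute is spent on it this cycle.
* §7 Formal consequences for lines (unchanged by §6): any stub asserting the RELATIVE/ess-sup form, `N`-uniformity,
  `p > 3`, or conditioning BEYOND `𝒢` (collision graph / normals: `𝒢⁺`-levers are dead on {d ≳ 2.4} by monotonicity of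
  the `L¹` defect in the σ-algebra, lead NOTES §B4) is refutable in the sense of §3–§4; `stub_core` of line `Sketch`
  (conditional flux law of the impact vector given `𝒢`, kernel form) carries the whole rigid-regime mixing content.
* §8a (gen 2, proved) `integral_indicator_mul_condExp_eq_sq`, `ipr_identity` — the IPR identity behind N4
  (`E[weight of own class] = E[Σ_c w_c²]`: truth negligible ⟺ no condensation).
* §8 (gen 2) WHY IT RESISTS — findings N1–N7, N4′ (informal, at the end of the file): longitudinal smearing makes
  `n = 0` polynomially safe (contra lead D2(e)); the attack surface is an early particle ANCHORED BY A CONTACT with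
  both anchors in the rigid core; the component partition of the inter-snapshot collision graph is `𝒢`-decodable;
  IPR identity (truth's posterior weight = inverse participation ratio ⇒ "kill" ⟺ posterior condensation);
  class weights ≈ prior × `e^{O(1)·#re-paired particles}` (the `1/J` tilt cancels against multiplicity at class
  level); local re-pairing budget `27ρ³e^{−β}` per slot against `(ℓ/ε)²` needed `ε`-cells — BOTH `∝ σ⁻⁶`, ratio
  `≈ 6e^{−β}` per slot, abundant from two slots on; conjectured sharp exponent `p = 3`. Targets/line: no stub of
  `Sketch` is cheaply false; `stub_floppy`'s `∃u₀ → 0` keeps `O(1)` mass only through the one-snapshot atom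
  (`n = 0`, `s_j = 0`) and `σ³` rings — consistent.

Evidence trail: W.lean (rc 0, one sorry: the decl elaborates verbatim); this file (rc 0, sorries only in
§3–§4); NOTES.md §Analysis; predecessor reports on the item: CRUX-ATTACK-14535.md (rattack-14535-0),
CRUX-ATTACK-9688-g3.md (3-ring TV numbers 0.22/0.52), REPAIR-9688.md (planner). Literature search this
session DEGRADED (local FTS db unavailable, OpenAlex/S2/arXiv 429): ring/recollision density scaling quoted
as kinetic-theory folklore (Dorfman 1999 p.172 density expansion & ring resummation; Dorfman–van Beijeren 1977),
not from a page hit.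
-/

namespace Summit.AtomisticToContinuum.HydrodynamicLimit.Cruxes.OneFlightLayeredChaos.Disproof

open MeasureTheory Set Filter
open Literature.Analysis.FluidPDE Literature.MathematicalPhysics.KineticTheory
open Summit.AtomisticToContinuum.HydrodynamicLimit.Theses.OneFlightGossipEngine

noncomputable section

/-! ## §0 The crux unfolded -/

/-- The DEFECT functional of the crux: `|P(W ∩ A ∩ E) − u(B)·P(W ∩ E)|` with the crux's own
`P, W, A, u` (lets inlined verbatim). [folklore] -/
def defect (a₀ θ₀ σ τ : ℝ) (n N : ℕ)
    (Φ : HardSphereFlow (Torus.geometry (Fin 3)) (hsDiameter σ N) (N + 1)) (i : Fin (N + 1))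
    (B : Set V3) (E : Set (Config (N + 1) (Fin 3) T3)) : ℝ :=
  |((localGibbsLaw σ (fun _ => a₀) (fun _ => 0) (fun _ => θ₀) N Φ)
      ({z | n + 1 ≤ Set.ncard (collisionTimesOf (Torus.geometry (Fin 3)) (hsDiameter σ N)
          (fun t => Φ.flow t z) i ∩ Set.Ioc 0 (τ * ((N + 1 : ℕ) : ℝ) ^ (-(1 / 3 : ℝ))))} ∩
        {z | (Φ.nthRecordOf i n z).outDir ∈ B} ∩ E)).toReal -
    (((sphereMeasure (E := V3)) Set.univ)⁻¹ *
        (sphereMeasure (E := V3)) {ω | (ω : V3) ∈ B}).toReal *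
      ((localGibbsLaw σ (fun _ => a₀) (fun _ => 0) (fun _ => θ₀) N Φ)
        ({z | n + 1 ≤ Set.ncard (collisionTimesOf (Torus.geometry (Fin 3)) (hsDiameter σ N)
            (fun t => Φ.flow t z) i ∩ Set.Ioc 0 (τ * ((N + 1 : ℕ) : ℝ) ^ (-(1 / 3 : ℝ))))} ∩ E)).toReal|

/-- The σ-algebra `𝒢` of the crux (coarse past of the `n`-th collision of `i` at mesh
`r_N = ρ (N+1)^{-1/3}`, and the partner's identity). [folklore] -/
abbrev pastSigma (σ ρ : ℝ) (n N : ℕ)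
    (Φ : HardSphereFlow (Torus.geometry (Fin 3)) (hsDiameter σ N) (N + 1)) (i : Fin (N + 1)) :
    MeasurableSpace (Config (N + 1) (Fin 3) T3) :=
  MeasurableSpace.comap (fun z => (Φ.coarsePastOf
    (Torus.coarseCell (ρ * ((N + 1 : ℕ) : ℝ) ^ (-(1 / 3 : ℝ)))) i n z, Φ.nthPartnerOf i n z))
    inferInstance

/-- The tail of the crux after `ρ` is fixed: `∀ τ > 0 ∀ n ∃ N₀ ∀ N ≥ N₀ ∀ Φ i B E, defect ≤ bound`,
with the bound allowed to depend on everything (used to state the mutations of §3–§4 uniformly).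
[folklore] -/
def Tail (a₀ θ₀ σ ρ : ℝ) (bound : ℝ) : Prop :=
  ∀ τ : ℝ, 0 < τ → ∀ n : ℕ, ∃ N₀ : ℕ, ∀ N : ℕ, N₀ ≤ N →
    ∀ Φ : HardSphereFlow (Torus.geometry (Fin 3)) (hsDiameter σ N) (N + 1),
    ∀ (i : Fin (N + 1)) (B : Set V3), MeasurableSet B →
    ∀ E : Set (Config (N + 1) (Fin 3) T3), MeasurableSet[pastSigma σ ρ n N Φ i] E →
      defect a₀ θ₀ σ τ n N Φ i B E ≤ bound

/-- The body of the crux after the profile binders `a₀ θ₀` (ledger signature verbatim). [folklore] -/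
def Body (a₀ θ₀ : ℝ) : Prop :=
  ∃ C : ℝ, 0 < C ∧ ∃ p : ℝ, 0 < p ∧ ∃ σ₀ : ℝ, 0 < σ₀ ∧ ∀ σ : ℝ, 0 < σ → σ < σ₀ → ∃ ρ : ℝ, σ ≤ ρ ∧ ρ * (Real.sqrt 2 * Real.pi * σ ^ 2) ≤ 1 ∧ ∀ τ : ℝ, 0 < τ → ∀ n : ℕ, ∃ N₀ : ℕ, ∀ N : ℕ, N₀ ≤ N → ∀ Φ : Literature.Analysis.FluidPDE.HardSphereFlow (Literature.Analysis.FluidPDE.Torus.geometry (Fin 3)) (Literature.MathematicalPhysics.KineticTheory.hsDiameter σ N) (N + 1), ∀ (i : Fin (N + 1)) (B : Set Literature.MathematicalPhysics.KineticTheory.V3), MeasurableSet B → let G : Literature.Analysis.FluidPDE.Geometry (Fin 3) Literature.MathematicalPhysics.KineticTheory.T3 := Literature.Analysis.FluidPDE.Torus.geometry (Fin 3); let ε : ℝ := Literature.MathematicalPhysics.KineticTheory.hsDiameter σ N; let w : ℝ := τ * ((N + 1 : ℕ) : ℝ) ^ (-(1 / 3 : ℝ)); let q : Literature.MathematicalPhysics.KineticTheory.T3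 → (Fin 3 → ℤ) := Literature.Analysis.FluidPDE.Torus.coarseCell (ρ * ((N + 1 : ℕ) : ℝ) ^ (-(1 / 3 : ℝ))); let P : MeasureTheory.Measure (Literature.Analysis.FluidPDE.Config (N + 1) (Fin 3) Literature.MathematicalPhysics.KineticTheory.T3) := Literature.MathematicalPhysics.KineticTheory.localGibbsLaw σ (fun _ => a₀) (fun _ => 0) (fun _ => θ₀) N Φ; let W : Set (Literature.Analysis.FluidPDE.Config (N + 1) (Fin 3) Literature.MathematicalPhysics.KineticTheory.T3) := {z | n + 1 ≤ Set.ncard (Literature.Analysis.FluidPDE.collisionTimesOf G ε (fun t => Φ.flow t z) i ∩ Set.Ioc 0 w)}; let A : Set (Literature.Analysis.FluidPDE.Config (N + 1) (Fin 3) Literature.MathematicalPhysics.KineticTheory.T3) := {z | (Φ.nthRecordOf i n z).outDir ∈ B}; let u : ℝ := (((Literature.MathematicalPhysics.KineticTheory.sphereMeasure (E := Literature.MathematicalPhysics.KineticTheory.V3)) Set.univ)⁻¹ * (Literature.MathematicalPhysics.KineticTheory.sphereMeasure (E := Literature.MathematicalPhysics.KineticTheory.V3)) {ω | (ω : Literature.MathematicalPhysics.KineticTheory.V3)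 ∈ B}).toReal; ∀ E : Set (Literature.Analysis.FluidPDE.Config (N + 1) (Fin 3) Literature.MathematicalPhysics.KineticTheory.T3), MeasurableSet[MeasurableSpace.comap (fun z => (Φ.coarsePastOf q i n z, Φ.nthPartnerOf i n z)) inferInstance] E → |(P (W ∩ A ∩ E)).toReal - u * (P (W ∩ E)).toReal| ≤ C * σ ^ p

/-- The route decl IS `∀ a₀ θ₀ > 0, Body a₀ θ₀` (syntactic identity). [folklore] -/
theorem oneFlightLayeredChaos_iff :
    OneFlightLayeredChaos ↔ ∀ a₀ θ₀ : ℝ, 0 < a₀ → 0 < θ₀ → Body a₀ θ₀ := Iff.rfl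

/-- `Body` in terms of the named tail/defect (the `let`s are definitionally inlined). [folklore] -/
theorem body_iff (a₀ θ₀ : ℝ) :
    Body a₀ θ₀ ↔ ∃ C : ℝ, 0 < C ∧ ∃ p : ℝ, 0 < p ∧ ∃ σ₀ : ℝ, 0 < σ₀ ∧ ∀ σ : ℝ, 0 < σ → σ < σ₀ →
      ∃ ρ : ℝ, σ ≤ ρ ∧ ρ * (Real.sqrt 2 * Real.pi * σ ^ 2) ≤ 1 ∧ Tail a₀ θ₀ σ ρ (C * σ ^ p) :=
  Iff.rfl

/-! ## §1 Non-vacuity and the trivial regime -/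

/-- **The flow quantifier is not vacuous**: for `0 < σ < 1/2` and every `N` the type of hard-sphere
flows of `N + 1` spheres of diameter `ε_N = σ (N+1)^{-1/3}` on `𝕋³` is inhabited (Alexander 1975, in
the tree). So neither side may argue from emptiness of `HardSphereFlow`. [cite: Alexander1975] -/
theorem nonempty_flow {σ : ℝ} (hσ : 0 < σ) (hσ2 : σ < 1 / 2) (N : ℕ) :
    Nonempty (HardSphereFlow (Torus.geometry (Fin 3)) (hsDiameter σ N) (N + 1)) :=
  HardSphereFlow.nonempty_torus_holds (d := Fin 3) (hsDiameter_pos hσ N)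
    (lt_of_le_of_lt (hsDiameter_le hσ.le N) (by rw [inv_eq_one_div]; exact hσ2)) (N + 1)

/-- The law `P` of the crux is a probability measure (`σ ≤ 1/2`, `a₀, θ₀ > 0`). [folklore] -/
theorem isProbabilityMeasure_P {a₀ θ₀ σ : ℝ} (ha : 0 < a₀) (hθ : 0 < θ₀) (hσ2 : σ ≤ 1 / 2) (N : ℕ)
    (Φ : HardSphereFlow (Torus.geometry (Fin 3)) (hsDiameter σ N) (N + 1)) :
    IsProbabilityMeasure (localGibbsLaw σ (fun _ => a₀) (fun _ => 0) (fun _ => θ₀) N Φ) :=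
  isProbabilityMeasure_localGibbsLaw continuous_const continuous_const continuous_const
    (fun _ => ha) (fun _ => hθ) hσ2 N Φ

/-- The surface measure of the unit sphere of `ℝ³` is finite. [folklore] -/
theorem isFiniteMeasure_sphereMeasure : IsFiniteMeasure (sphereMeasure (E := V3)) := by
  unfold sphereMeasure; infer_instance

/-- The surface measure of the unit sphere of `ℝ³` is nonzero. [folklore] -/
theorem sphereMeasure_univ_ne_zero : (sphereMeasure (E := V3)) Set.univ ≠ 0 := by
  unfold sphereMeasure
  exact Measure.measure_univ_ne_zero.2 (Measure.toSphere_ne_zero _)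

/-- The centring `u(B)` of the crux is nonnegative. [folklore] -/
theorem u_nonneg (B : Set V3) :
    0 ≤ (((sphereMeasure (E := V3)) Set.univ)⁻¹ * (sphereMeasure (E := V3)) {ω | (ω : V3) ∈ B}).toReal :=
  ENNReal.toReal_nonneg

/-- The centring `u(B)` of the crux is at most `1` (it is the uniform probability of `B ∩ S²`).
[folklore] -/
theorem u_le_one (B : Set V3) :
    (((sphereMeasure (E := V3)) Set.univ)⁻¹ * (sphereMeasure (E := V3)) {ω | (ω : V3) ∈ B}).toReal ≤ 1 := by
  haveI := isFiniteMeasure_sphereMeasure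
  have hle : ((sphereMeasure (E := V3)) Set.univ)⁻¹ * (sphereMeasure (E := V3)) {ω | (ω : V3) ∈ B} ≤ 1 := by
    calc ((sphereMeasure (E := V3)) Set.univ)⁻¹ * (sphereMeasure (E := V3)) {ω | (ω : V3) ∈ B}
        ≤ ((sphereMeasure (E := V3)) Set.univ)⁻¹ * (sphereMeasure (E := V3)) Set.univ := by
          gcongr; exact Set.subset_univ _
      _ = 1 := ENNReal.inv_mul_cancel sphereMeasure_univ_ne_zero (measure_ne_top _ _)
  simpa using ENNReal.toReal_mono ENNReal.one_ne_top hle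

/-- **Abstract trivial bound.** For any finite measure and any `u ∈ [0,1]`:
`|P(W ∩ A ∩ E) − u·P(W ∩ E)| ≤ P(W ∩ E)`. [folklore] -/
theorem abs_sub_mul_le_measure {Ω : Type*} [MeasurableSpace Ω] (P : Measure Ω) [IsFiniteMeasure P]
    (W A E : Set Ω) {u : ℝ} (hu0 : 0 ≤ u) (hu1 : u ≤ 1) :
    |(P (W ∩ A ∩ E)).toReal - u * (P (W ∩ E)).toReal| ≤ (P (W ∩ E)).toReal := by
  have hle : (P (W ∩ A ∩ E)).toReal ≤ (P (W ∩ E)).toReal :=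
    ENNReal.toReal_mono (measure_ne_top _ _) (measure_mono fun z hz => ⟨hz.1.1, hz.2⟩)
  have ha : 0 ≤ (P (W ∩ A ∩ E)).toReal := ENNReal.toReal_nonneg
  have hb : 0 ≤ (P (W ∩ E)).toReal := ENNReal.toReal_nonneg
  rw [abs_le]
  constructor <;> nlinarith

/-- **The defect never exceeds `P(W ∩ E)`** (so rare pasts cannot be blamed: an event of mass
`≤ C σ^p` satisfies the crux inequality whatever happens on it — the AVERAGED form is what is claimed).
[folklore] -/
theorem defect_le_measure {a₀ θ₀ σ : ℝ} (ha : 0 < a₀) (hθ : 0 < θ₀) (hσ2 : σ ≤ 1 / 2) (τ : ℝ)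
    (n N : ℕ) (Φ : HardSphereFlow (Torus.geometry (Fin 3)) (hsDiameter σ N) (N + 1)) (i : Fin (N + 1))
    (B : Set V3) (E : Set (Config (N + 1) (Fin 3) T3)) :
    defect a₀ θ₀ σ τ n N Φ i B E ≤
      ((localGibbsLaw σ (fun _ => a₀) (fun _ => 0) (fun _ => θ₀) N Φ)
        ({z | n + 1 ≤ Set.ncard (collisionTimesOf (Torus.geometry (Fin 3)) (hsDiameter σ N)
            (fun t => Φ.flow t z) i ∩ Set.Ioc 0 (τ * ((N + 1 : ℕ) : ℝ) ^ (-(1 / 3 : ℝ))))} ∩ E)).toReal := by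
  haveI := isProbabilityMeasure_P ha hθ hσ2 N Φ
  exact abs_sub_mul_le_measure _ _ _ _ (u_nonneg B) (u_le_one B)

/-- **Trivial regime**: the defect is always `≤ 1`. [folklore] -/
theorem defect_le_one {a₀ θ₀ σ : ℝ} (ha : 0 < a₀) (hθ : 0 < θ₀) (hσ2 : σ ≤ 1 / 2) (τ : ℝ)
    (n N : ℕ) (Φ : HardSphereFlow (Torus.geometry (Fin 3)) (hsDiameter σ N) (N + 1)) (i : Fin (N + 1))
    (B : Set V3) (E : Set (Config (N + 1) (Fin 3) T3)) :
    defect a₀ θ₀ σ τ n N Φ i B E ≤ 1 := by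
  haveI := isProbabilityMeasure_P ha hθ hσ2 N Φ
  refine (defect_le_measure ha hθ hσ2 τ n N Φ i B E).trans ?_
  exact (ENNReal.toReal_mono ENNReal.one_ne_top prob_le_one).trans_eq ENNReal.toReal_one

/-- **The crux inequality is void iff `C σ^p ≥ 1`**: for such parameters the whole tail holds with
`N₀ = 0`, for EVERY `ρ`, by the trivial bound alone. Since `C, p` precede `σ → 0` in the crux, this
regime is eventually left — the statement has content ((M2) of the predecessor is repaired). [folklore] -/
theorem tail_of_one_le {a₀ θ₀ σ : ℝ} (ha : 0 < a₀) (hθ : 0 < θ₀) (hσ2 : σ ≤ 1 / 2) (ρ : ℝ)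
    {K : ℝ} (hK : 1 ≤ K) : Tail a₀ θ₀ σ ρ K :=
  fun τ _ n => ⟨0, fun N _ Φ i B _ E _ => (defect_le_one ha hθ hσ2 τ n N Φ i B E).trans hK⟩

/-- Collision times of a particle in a one-particle (or empty) system: none. [folklore] -/
theorem collisionTimesOf_eq_empty_of_subsingleton {d X : Type*} [Fintype d] {N : ℕ}
    [Subsingleton (Fin N)] (G : Geometry d X) (ε : ℝ) (γ : ℝ → Config N d X) (k : Fin N) :
    collisionTimesOf G ε γ k = ∅ := by
  ext t
  simp only [mem_collisionTimesOf, Set.mem_empty_iff_false, iff_false]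
  rintro ⟨j, h⟩
  exact h.ne (Subsingleton.elim _ _)

/-- **Degenerate instance `N = 0` (one sphere)**: no collisions, `W = ∅`, the defect vanishes for every
flow, `B`, `E` — the small-`N` content of the crux starts at `N = 1` (two spheres), which `N₀(σ, …)`
excludes. [folklore] -/
theorem defect_zero_particles (a₀ θ₀ σ τ : ℝ) (n : ℕ)
    (Φ : HardSphereFlow (Torus.geometry (Fin 3)) (hsDiameter σ 0) (0 + 1)) (i : Fin (0 + 1))
    (B : Set V3) (E : Set (Config (0 + 1) (Fin 3) T3)) :
    defect a₀ θ₀ σ τ n 0 Φ i B E = 0 := by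
  haveI : Subsingleton (Fin (0 + 1)) := ⟨fun a b => Fin.ext (by omega)⟩
  have hW : {z : Config (0 + 1) (Fin 3) T3 | n + 1 ≤ Set.ncard (collisionTimesOf (Torus.geometry (Fin 3))
      (hsDiameter σ 0) (fun t => Φ.flow t z) i ∩ Set.Ioc 0 (τ * ((0 + 1 : ℕ) : ℝ) ^ (-(1 / 3 : ℝ))))} = ∅ := by
    ext z
    simp [collisionTimesOf_eq_empty_of_subsingleton]
  rw [defect, hW]
  simp

/-- **Degenerate `B = ∅`**: `A = ∅`, `u(∅) = 0`, the defect vanishes identically. [folklore] -/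
theorem defect_empty (a₀ θ₀ σ τ : ℝ) (n N : ℕ)
    (Φ : HardSphereFlow (Torus.geometry (Fin 3)) (hsDiameter σ N) (N + 1)) (i : Fin (N + 1))
    (E : Set (Config (N + 1) (Fin 3) T3)) : defect a₀ θ₀ σ τ n N Φ i ∅ E = 0 := by
  simp [defect]

/-- **Degenerate `B = univ` (`⊇ S²`)**: `A = univ`, `u = 1`, the defect vanishes identically — so the
content of the crux sits strictly between, e.g. at half-spaces `B` (`u = 1/2`). [folklore] -/
theorem defect_univ (a₀ θ₀ σ τ : ℝ) (n N : ℕ)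
    (Φ : HardSphereFlow (Torus.geometry (Fin 3)) (hsDiameter σ N) (N + 1)) (i : Fin (N + 1))
    (E : Set (Config (N + 1) (Fin 3) T3)) : defect a₀ θ₀ σ τ n N Φ i Set.univ E = 0 := by
  haveI := isFiniteMeasure_sphereMeasure
  have hu : ((sphereMeasure (E := V3)) Set.univ)⁻¹ * (sphereMeasure (E := V3)) Set.univ = 1 :=
    ENNReal.inv_mul_cancel sphereMeasure_univ_ne_zero (measure_ne_top _ _)
  simp [defect, hu]

/-! ## §2 Hypothesis mutation, formal part: the activity drops out -/

/-- Tensor powers scale: `(c f)^{⊗n} = c^n f^{⊗n}`. [folklore] -/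
theorem tensorPow_const_mul {d : Type*} [Fintype d] {X : Type*} (c : ℝ) (n : ℕ)
    (f : X × EuclideanSpace ℝ d → ℝ) (w : Config n d X) :
    tensorPow n (fun y => c * f y) w = c ^ n * tensorPow n f w := by
  simp [tensorPow, Finset.prod_mul_distrib, Finset.prod_const]

/-- **The canonical density is invariant under scaling the one-particle profile** by a nonzero
constant (the partition function scales by the same `c^n`). [folklore] -/
theorem canonicalDensity_const_mul {d : Type*} [Fintype d] {X : Type*} [MeasureSpace X]
    (G : Geometry d X) (ε : ℝ) (n : ℕ) (f : X × EuclideanSpace ℝ d → ℝ) {c : ℝ} (hc : c ≠ 0) :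
    canonicalDensity G ε n (fun y => c * f y) = canonicalDensity G ε n f := by
  have hind : (hardSphereDomain G n ε).indicator (tensorPow n fun y => c * f y) =
      fun w => c ^ n * (hardSphereDomain G n ε).indicator (tensorPow n f) w := by
    funext w
    by_cases hw : w ∈ hardSphereDomain G n ε
    · simp [Set.indicator_of_mem hw, tensorPow_const_mul]
    · simp [Set.indicator_of_notMem hw]
  have hZ : canonicalPartition G ε n (fun y => c * f y) = c ^ n * canonicalPartition G ε n f := by
    simp only [canonicalPartition, hind, integral_const_mul]
  funext z
  simp only [canonicalDensity, hZ, hind, mul_inv]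
  have hcn : c ^ n ≠ 0 := pow_ne_zero n hc
  field_simp

/-- A constant activity factors out of the local Gibbs profile. [folklore] -/
theorem localGibbsProfile_const_activity (a₀ : ℝ) (u₀ : T3 → V3) (θ₀ : T3 → ℝ) :
    localGibbsProfile (fun _ => a₀) u₀ θ₀ = fun y => a₀ * localGibbsProfile (fun _ => 1) u₀ θ₀ y := by
  funext y
  simp [localGibbsProfile]

/-- **The activity drops out of the canonical local Gibbs law**: for constant `a₀ ≠ 0`,
`localGibbsLaw σ a₀ u₀ θ₀ N Φ = localGibbsLaw σ 1 u₀ θ₀ N Φ`. [folklore] -/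
theorem localGibbsLaw_const_activity {a₀ : ℝ} (ha : a₀ ≠ 0) (σ : ℝ) (u₀ : T3 → V3) (θ₀ : T3 → ℝ)
    (N : ℕ) (Φ : HardSphereFlow (Torus.geometry (Fin 3)) (hsDiameter σ N) (N + 1)) :
    localGibbsLaw σ (fun _ => a₀) u₀ θ₀ N Φ = localGibbsLaw σ (fun _ => 1) u₀ θ₀ N Φ := by
  rw [localGibbsLaw, localGibbsLaw, localGibbsProfile_const_activity a₀,
    canonicalDensity_const_mul _ _ _ _ ha]

/-- With zero activity the "local Gibbs law" is the zero measure (junk regime `a₀ = 0`). [folklore] -/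
theorem localGibbsLaw_zero_activity (σ : ℝ) (u₀ : T3 → V3) (θ₀ : T3 → ℝ)
    (N : ℕ) (Φ : HardSphereFlow (Torus.geometry (Fin 3)) (hsDiameter σ N) (N + 1)) :
    localGibbsLaw σ (fun _ => 0) u₀ θ₀ N Φ = 0 := by
  rw [localGibbsLaw, particleLaw_eq]
  have : canonicalDensity (Torus.geometry (Fin 3)) (hsDiameter σ N) (N + 1)
      (localGibbsProfile (fun _ => (0 : ℝ)) u₀ θ₀) = fun _ => 0 := by
    funext z
    have htp : tensorPow (N + 1) (localGibbsProfile (fun _ => (0 : ℝ)) u₀ θ₀) = fun _ => 0 := by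
      funext w
      simp [tensorPow, localGibbsProfile]
    simp [canonicalDensity, htp]
  simp [this]

/-- The body of the crux does not see the (nonzero) activity. [folklore] -/
theorem body_iff_body_one {a₀ : ℝ} (ha : a₀ ≠ 0) (θ₀ : ℝ) : Body a₀ θ₀ ↔ Body 1 θ₀ := by
  simp only [Body, localGibbsLaw_const_activity ha]

/-- `√2 · π · σ³ ≤ 1` for `0 ≤ σ ≤ 1/2`: the admissible range `[σ, (√2πσ²)⁻¹]` for `ρ` is nonempty,
`ρ = σ` being admissible. [folklore] -/
theorem rho_range_nonempty {σ : ℝ} (hσ : 0 ≤ σ) (hσ2 : σ ≤ 1 / 2) :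
    σ * (Real.sqrt 2 * Real.pi * σ ^ 2) ≤ 1 := by
  have hs : Real.sqrt 2 ≤ 2 := by
    have h := Real.sqrt_le_sqrt (show (2 : ℝ) ≤ 2 ^ 2 by norm_num)
    rwa [Real.sqrt_sq (by norm_num : (0 : ℝ) ≤ 2)] at h
  have hpi : Real.pi ≤ 4 := Real.pi_le_four
  have hs0 : 0 ≤ Real.sqrt 2 := Real.sqrt_nonneg 2
  have hσ3 : σ ^ 3 ≤ (1 / 2) ^ 3 := pow_le_pow_left₀ hσ hσ2 3
  calc σ * (Real.sqrt 2 * Real.pi * σ ^ 2) = Real.sqrt 2 * Real.pi * σ ^ 3 := by ring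
    _ ≤ 2 * 4 * (1 / 2) ^ 3 := by gcongr
    _ ≤ 1 := by norm_num

/-- In the junk regime `a₀ = 0` the body holds trivially (zero measure: both sides vanish). [folklore] -/
theorem body_zero (θ₀ : ℝ) : Body 0 θ₀ := by
  refine ⟨1, one_pos, 1, one_pos, 1 / 2, by norm_num, fun σ hσ hσ2 =>
    ⟨σ, le_rfl, rho_range_nonempty hσ.le hσ2.le, fun τ _ n => ⟨0, fun N _ Φ i B _ => ?_⟩⟩⟩
  intro G ε w q P W A u E _
  simp only [P, localGibbsLaw_zero_activity]
  simp
  positivity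

/-- **`0 < a₀` is decoration.** The crux is equivalent to its activity-free form (and, by
`body_iff_body_one`, to the single case `a₀ = 1`). [folklore] -/
theorem oneFlightLayeredChaos_iff_activity_free :
    OneFlightLayeredChaos ↔ ∀ a₀ θ₀ : ℝ, 0 < θ₀ → Body a₀ θ₀ := by
  rw [oneFlightLayeredChaos_iff]
  constructor
  · intro h a₀ θ₀ hθ
    by_cases ha : a₀ = 0
    · rw [ha]; exact body_zero θ₀
    · rw [body_iff_body_one ha]; exact h 1 θ₀ one_pos hθ
  · exact fun h a₀ θ₀ _ hθ => h a₀ θ₀ hθ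

/-- The one-activity reduction provers should use: it suffices to treat `a₀ = 1`. [folklore] -/
theorem oneFlightLayeredChaos_iff_one :
    OneFlightLayeredChaos ↔ ∀ θ₀ : ℝ, 0 < θ₀ → Body 1 θ₀ := by
  rw [oneFlightLayeredChaos_iff_activity_free]
  constructor
  · exact fun h θ₀ hθ => h 1 θ₀ hθ
  · intro h a₀ θ₀ hθ
    by_cases ha : a₀ = 0
    · rw [ha]; exact body_zero θ₀
    · rw [body_iff_body_one ha]; exact h θ₀ hθ

/-! ## §2b Load-bearing analysis of the `∃ ρ` freedom: mesh monotonicity (gen 2, all proved)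

Nested meshes give nested pasts: the torus cells of size `m·r`, `m : ℕ`, are unions of cells of size `r`
(`⌊y/(m r)⌋ = ⌊y/r⌋ / m`, no sign hypothesis, `m = 0` included), so the generating map of `𝒢` at mesh `m ρ`
factors through a measurable recoding of the one at mesh `ρ`, `𝒢_{mρ} ≤ 𝒢_ρ`, and the tail of the crux at `ρ`
IMPLIES the tail at `m ρ` (fewer test events). Consequences: (i) `body_iff_topOctave` — the crux is
equivalent to the same statement with `ρ` confined to the top octave `1/2 < ρ √2πσ² ≤ 1` (cells of ½–1 mean
free path): provers lose nothing there, refuters need only kill such meshes; (ii) `tail_zero_of_tail` — the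
velocity-only past (`m = 0`, all cells recoded to `0`: exact velocities at the two flight starts + partner) is
the bottom of the ladder, implied by every mesh; (iii) CAVEAT for line `Sketch`: its stubs fix the mesh at
`ρ⋆ = (√2πσ²)⁻¹`; a refutation of `stub_dust` at `ρ⋆` refutes the crux only along the meshes `ρ⋆/m` (non-nested
meshes `r < r'` have INCOMPARABLE σ-algebras — two points in one `r'`-cell may sit in different `r`-cells and
vice versa), so "a refutation of THIS stub refutes the typed crux itself" in its docstring is true physically,
not formally. Landed separately as `Theorems/OneFlightLayeredChaos/Negative/MeshMonotone.lean` (p121771; self-contained,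
definition-free copy stated over the route decl's own tail text: `pastSigma_natCast_mul_le`, `tail_natCast_mul`,
`oneFlightLayeredChaos_iff_tail`, `oneFlightLayeredChaos_iff_topOctave`; a Theorems file may not import this workfile). -/

/-- Cells of size `m · r` are read off cells of size `r`: `⌊y/(m r)⌋ = ⌊y/r⌋ / m`. [folklore] -/
theorem coarseCell_natCast_mul {d : Type*} (m : ℕ) (r : ℝ) (x : UnitAddTorus d) :
    Torus.coarseCell ((m : ℝ) * r) x = fun k => Torus.coarseCell r x k / (m : ℤ) := by
  funext k
  simp only [Torus.coarseCell]
  rw [mul_comm, ← div_div, Int.floor_div_natCast]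

/-- The recoding of cell indices `c ↦ c / m` on a coarse configuration (positions through cells,
velocities exact). [folklore] -/
def recode {M : ℕ} (m : ℕ) (f : Fin M → (Fin 3 → ℤ) × V3) : Fin M → (Fin 3 → ℤ) × V3 :=
  fun k => (fun l => (f k).1 l / (m : ℤ), (f k).2)

/-- The recoding is measurable (cell indices live in a countable discrete space). [folklore] -/
theorem measurable_recode {M : ℕ} (m : ℕ) : Measurable (recode (M := M) m) := by
  refine measurable_pi_lambda _ fun k => ?_
  refine Measurable.prodMk ?_ ?_
  · exact (Measurable.of_discrete (f := fun c : Fin 3 → ℤ => fun l => c l / (m : ℤ))).comp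
      ((measurable_pi_apply k).fst)
  · exact (measurable_pi_apply k).snd

/-- The recoding on the generating datum `((coarse config at s_i, coarse config at s_j), partner)`.
[folklore] -/
def recodePast {M : ℕ} (m : ℕ)
    (p : ((Fin M → (Fin 3 → ℤ) × V3) × (Fin M → (Fin 3 → ℤ) × V3)) × Fin M) :
    ((Fin M → (Fin 3 → ℤ) × V3) × (Fin M → (Fin 3 → ℤ) × V3)) × Fin M :=
  ((recode m p.1.1, recode m p.1.2), p.2)

/-- The recoding of the generating datum is measurable. [folklore] -/
theorem measurable_recodePast {M : ℕ} (m : ℕ) : Measurable (recodePast (M := M) m) :=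
  (((measurable_recode m).comp measurable_fst.fst).prodMk
    ((measurable_recode m).comp measurable_fst.snd)).prodMk measurable_snd

/-- Coarse-graining a configuration through cells of size `m r` = recoding its coarse-graining through
cells of size `r`. [folklore] -/
theorem coarseConfig_natCast_mul {M : ℕ} (m : ℕ) (r : ℝ) (w : Config M (Fin 3) T3) :
    coarseConfig (Torus.coarseCell ((m : ℝ) * r)) w = recode m (coarseConfig (Torus.coarseCell r) w) := by
  funext k
  simp [coarseConfig, recode, coarseCell_natCast_mul]

/-- The generating map of `𝒢` at mesh `m r` factors through the one at mesh `r`. [folklore] -/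
theorem pastGen_natCast_mul {N : ℕ} {ε : ℝ} (Φ : HardSphereFlow (Torus.geometry (Fin 3)) ε (N + 1))
    (i : Fin (N + 1)) (n m : ℕ) (r : ℝ) :
    (fun z => (Φ.coarsePastOf (Torus.coarseCell ((m : ℝ) * r)) i n z, Φ.nthPartnerOf i n z)) =
      recodePast m ∘ (fun z => (Φ.coarsePastOf (Torus.coarseCell r) i n z, Φ.nthPartnerOf i n z)) := by
  funext z
  simp only [Function.comp_apply, recodePast, HardSphereFlow.coarsePastOf, coarseConfig_natCast_mul]

/-- **Nested meshes give nested pasts**: `𝒢` at mesh `m ρ` is contained in `𝒢` at mesh `ρ`. [folklore] -/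
theorem pastSigma_natCast_mul_le (σ ρ : ℝ) (n N m : ℕ)
    (Φ : HardSphereFlow (Torus.geometry (Fin 3)) (hsDiameter σ N) (N + 1)) (i : Fin (N + 1)) :
    pastSigma σ ((m : ℝ) * ρ) n N Φ i ≤ pastSigma σ ρ n N Φ i := by
  dsimp only [pastSigma]
  rw [mul_assoc, pastGen_natCast_mul, ← MeasurableSpace.comap_comp]
  exact MeasurableSpace.comap_mono (measurable_recodePast m).comap_le

/-- **Mesh monotonicity of the tail**: `Tail` at mesh `ρ` implies `Tail` at every nested coarser mesh
`m ρ` (same bound, same `N₀`). [folklore] -/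
theorem tail_natCast_mul {a₀ θ₀ σ ρ bound : ℝ} (m : ℕ) (h : Tail a₀ θ₀ σ ρ bound) :
    Tail a₀ θ₀ σ ((m : ℝ) * ρ) bound := by
  intro τ hτ n
  obtain ⟨N₀, hN⟩ := h τ hτ n
  exact ⟨N₀, fun N hNN Φ i B hB E hE =>
    hN N hNN Φ i B hB E (pastSigma_natCast_mul_le σ ρ n N m Φ i E hE)⟩

/-- **The velocity-only past is the bottom of the ladder** (`m = 0`): the tail at any mesh implies the
tail for `σ(exact velocities at the two flight starts, partner)` (`coarseCell 0 ≡ 0`). [folklore] -/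
theorem tail_zero_of_tail {a₀ θ₀ σ ρ bound : ℝ} (h : Tail a₀ θ₀ σ ρ bound) : Tail a₀ θ₀ σ 0 bound := by
  simpa using tail_natCast_mul 0 h

/-- Arithmetic of the top octave: for `0 < c`, `0 < ρ`, `ρ c ≤ 1`, the integer `m = ⌊(ρ c)⁻¹⌋₊ ≥ 1` has
`m ρ c ≤ 1` and `1/2 < m ρ c`. [folklore] -/
theorem exists_natCast_mul_mem_topOctave {ρ c : ℝ} (hρ : 0 < ρ) (hc : 0 < c) (h1 : ρ * c ≤ 1) :
    ∃ m : ℕ, 1 ≤ m ∧ (m : ℝ) * ρ * c ≤ 1 ∧ 1 < 2 * ((m : ℝ) * ρ * c) := by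
  have hx : 0 < ρ * c := mul_pos hρ hc
  set x : ℝ := ρ * c with hxdef
  refine ⟨⌊x⁻¹⌋₊, ?_, ?_, ?_⟩
  · exact Nat.one_le_floor_iff _ |>.2 (one_le_inv_iff₀.2 ⟨hx, h1⟩)
  · have hfl : (⌊x⁻¹⌋₊ : ℝ) ≤ x⁻¹ := Nat.floor_le (inv_nonneg.2 hx.le)
    calc (⌊x⁻¹⌋₊ : ℝ) * ρ * c = (⌊x⁻¹⌋₊ : ℝ) * x := by rw [hxdef]; ring
      _ ≤ x⁻¹ * x := by gcongr
      _ = 1 := inv_mul_cancel₀ hx.ne'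
  · have hlt : x⁻¹ < (⌊x⁻¹⌋₊ : ℝ) + 1 := Nat.lt_floor_add_one _
    have hm : x⁻¹ - 1 < (⌊x⁻¹⌋₊ : ℝ) := by linarith
    rcases le_or_gt x (1 / 2) with hxh | hxh
    · have h2 : (x⁻¹ - 1) * x < (⌊x⁻¹⌋₊ : ℝ) * x := by gcongr
      have h3 : (x⁻¹ - 1) * x = 1 - x := by field_simp
      calc (1 : ℝ) ≤ 2 * ((x⁻¹ - 1) * x) := by rw [h3]; linarith
        _ < 2 * ((⌊x⁻¹⌋₊ : ℝ) * x) := by linarith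
        _ = 2 * ((⌊x⁻¹⌋₊ : ℝ) * ρ * c) := by rw [hxdef]; ring
    · have hm1 : (1 : ℝ) ≤ (⌊x⁻¹⌋₊ : ℝ) := by
        exact_mod_cast Nat.one_le_floor_iff _ |>.2 (one_le_inv_iff₀.2 ⟨hx, h1⟩)
      calc (1 : ℝ) < 2 * (1 * x) := by linarith
        _ ≤ 2 * ((⌊x⁻¹⌋₊ : ℝ) * x) := by gcongr
        _ = 2 * ((⌊x⁻¹⌋₊ : ℝ) * ρ * c) := by rw [hxdef]; ring

/-- **WLOG the mesh is in the top octave**: `Body` is equivalent to `Body` with `ρ` confined to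
`1/2 < ρ √2πσ² ≤ 1` (cells between half and one mean free path). [folklore] -/
theorem body_iff_topOctave (a₀ θ₀ : ℝ) :
    Body a₀ θ₀ ↔ ∃ C : ℝ, 0 < C ∧ ∃ p : ℝ, 0 < p ∧ ∃ σ₀ : ℝ, 0 < σ₀ ∧ ∀ σ : ℝ, 0 < σ → σ < σ₀ →
      ∃ ρ : ℝ, σ ≤ ρ ∧ ρ * (Real.sqrt 2 * Real.pi * σ ^ 2) ≤ 1 ∧
        1 < 2 * (ρ * (Real.sqrt 2 * Real.pi * σ ^ 2)) ∧ Tail a₀ θ₀ σ ρ (C * σ ^ p) := by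
  rw [body_iff]
  constructor
  · rintro ⟨C, hC, p, hp, σ₀, hσ₀, hσ⟩
    refine ⟨C, hC, p, hp, σ₀, hσ₀, fun σ hs hs₀ => ?_⟩
    obtain ⟨ρ, hσρ, hρ1, hT⟩ := hσ σ hs hs₀
    have hc : 0 < Real.sqrt 2 * Real.pi * σ ^ 2 := by positivity
    have hρ : 0 < ρ := hs.trans_le hσρ
    obtain ⟨m, hm1, hmle, hmgt⟩ := exists_natCast_mul_mem_topOctave hρ hc hρ1
    refine ⟨(m : ℝ) * ρ, ?_, by simpa [mul_assoc] using hmle, by simpa [mul_assoc] using hmgt,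
      tail_natCast_mul m hT⟩
    have hm1' : (1 : ℝ) ≤ m := by exact_mod_cast hm1
    calc σ ≤ ρ := hσρ
      _ = 1 * ρ := (one_mul ρ).symm
      _ ≤ (m : ℝ) * ρ := by gcongr
  · rintro ⟨C, hC, p, hp, σ₀, hσ₀, hσ⟩
    refine ⟨C, hC, p, hp, σ₀, hσ₀, fun σ hs hs₀ => ?_⟩
    obtain ⟨ρ, hσρ, hρ1, _, hT⟩ := hσ σ hs hs₀
    exact ⟨ρ, hσρ, hρ1, hT⟩

/-- The crux BY NAME in top-octave form. [folklore] -/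
theorem oneFlightLayeredChaos_iff_topOctave :
    OneFlightLayeredChaos ↔ ∀ θ₀ : ℝ, 0 < θ₀ → ∃ C : ℝ, 0 < C ∧ ∃ p : ℝ, 0 < p ∧ ∃ σ₀ : ℝ, 0 < σ₀ ∧
      ∀ σ : ℝ, 0 < σ → σ < σ₀ → ∃ ρ : ℝ, σ ≤ ρ ∧ ρ * (Real.sqrt 2 * Real.pi * σ ^ 2) ≤ 1 ∧
        1 < 2 * (ρ * (Real.sqrt 2 * Real.pi * σ ^ 2)) ∧ Tail 1 θ₀ σ ρ (C * σ ^ p) := by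
  rw [oneFlightLayeredChaos_iff_one]
  exact forall₂_congr fun θ₀ _ => body_iff_topOctave 1 θ₀

/-! ## §3 Load-bearing analysis, dynamical part (near-misses: `sorry`, obstruction documented)

Conventions: `s_i`, `s_j` = flight starts of `i` and of its `n`-th partner `j`; `t_n` = the `n`-th
collision time of `i`; `b` = impact parameter of that collision in the plane `⊥ g`, `g = v_i − v_j`;
`r = ρ(N+1)^{-1/3}` (cell), `ε = σ(N+1)^{-1/3}` (diameter), `ℓ = (N+1)^{-1/3}/(√2πσ²)` (mean free path). -/

/-- MUTATION (H-N₀): `N₀` chosen BEFORE `σ` (uniformity in bounded `N`). [folklore] -/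
def BodyUniformN (a₀ θ₀ : ℝ) : Prop :=
  ∃ C : ℝ, 0 < C ∧ ∃ p : ℝ, 0 < p ∧ ∃ N₀ : ℕ, ∃ σ₀ : ℝ, 0 < σ₀ ∧ ∀ σ : ℝ, 0 < σ → σ < σ₀ →
    ∃ ρ : ℝ, σ ≤ ρ ∧ ρ * (Real.sqrt 2 * Real.pi * σ ^ 2) ≤ 1 ∧
    ∀ τ : ℝ, 0 < τ → ∀ n : ℕ, ∀ N : ℕ, N₀ ≤ N →
    ∀ Φ : HardSphereFlow (Torus.geometry (Fin 3)) (hsDiameter σ N) (N + 1),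
    ∀ (i : Fin (N + 1)) (B : Set V3), MeasurableSet B →
    ∀ E : Set (Config (N + 1) (Fin 3) T3), MeasurableSet[pastSigma σ ρ n N Φ i] E →
      defect a₀ θ₀ σ τ n N Φ i B E ≤ C * σ ^ p

/-- **Any proof must use that `N₀` comes after `σ`** (near-miss, not closed). With `N₀` before `σ`
the refuter answers with `N = N₀` FIXED and `σ → 0`, `τ ≍ σ⁻²` (so that `P(W) ≍ 1`): `N₀ + 1` spheres of
vanishing diameter on the unit torus whose free flights wrap around the torus `≍ σ⁻²` times between
collisions — the periodic-Lorentz / Boltzmann–Grad-on-𝕋³ regime. At `N₀ = 1` (two spheres = the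
ℤ³-periodic Lorentz gas in the relative coordinate) the Marklof–Strömbergsson limit kernel of the next
impact parameter GIVEN the previous one is not uniform (`K(0|0) ≥ ζ(3)⁻¹(1 − 3/(2π)) ≈ 0.4347 > 1/π`,
predecessor report CRUX-ATTACK-9688 / ms_kernel_check), and the previous impact parameter is
`𝒢`-measurable (exact pre/post velocities) ⇒ `liminf_{σ→0} sup_E defect > 0` at `N = 1`.
OBSTRUCTION to closing in Lean: the Boltzmann–Grad limit of the periodic Lorentz gas
(Marklof–Strömbergsson 2010/2011) is not in the tree; for `N₀ > 1` even the paper statement is open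
(expected: same phenomenon). [cite: MarklofStrombergsson2011] -/
theorem not_bodyUniformN : ¬ ∀ θ₀ : ℝ, 0 < θ₀ → BodyUniformN 1 θ₀ := by
  sorry

/-- MUTATION (H-𝒢): the conditioning restriction `E ∈ 𝒢` dropped (all events `E`; the mesh `ρ` then
plays no role). [folklore] -/
def TailAllEvents (a₀ θ₀ σ : ℝ) (bound : ℝ) : Prop :=
  ∀ τ : ℝ, 0 < τ → ∀ n : ℕ, ∃ N₀ : ℕ, ∀ N : ℕ, N₀ ≤ N →
    ∀ Φ : HardSphereFlow (Torus.geometry (Fin 3)) (hsDiameter σ N) (N + 1),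
    ∀ (i : Fin (N + 1)) (B : Set V3), MeasurableSet B →
    ∀ E : Set (Config (N + 1) (Fin 3) T3), defect a₀ θ₀ σ τ n N Φ i B E ≤ bound

/-- **Any proof must use `E ∈ 𝒢`** (near-miss, not closed): with `E := A` (the kick event itself,
which is NOT `𝒢`-measurable) the defect is `(1 − u(B))·P(W ∩ A)`; for `B` a half-space (`u = 1/2`) and
`τ → ∞` (`P(W) → 1`, `P(W ∩ A) → 1/2` by the `ω ↦ −ω` symmetry of the contact law) it tends to `1/4`,
for every `σ`. OBSTRUCTION: needs `P(W ∩ A) ≥ c > 0` uniformly in `N ≥ N₀`, i.e. a collision-frequency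
LOWER bound for a tagged sphere under the Gibbs law through the `ncard (collisionTimesOf …)` /
`nthRecordOf` bookkeeping — honest many-body dynamics, prover-grade. [folklore] -/
theorem not_tailAllEvents : ¬ ∀ θ₀ : ℝ, 0 < θ₀ → ∃ C : ℝ, 0 < C ∧ ∃ p : ℝ, 0 < p ∧ ∃ σ₀ : ℝ, 0 < σ₀ ∧
    ∀ σ : ℝ, 0 < σ → σ < σ₀ → TailAllEvents 1 θ₀ σ (C * σ ^ p) := by
  sorry

/-- MUTATION (H-avg): the RELATIVE (ess-sup / pointwise-conditional) form — defect `≤ bound · P(W ∩ E)`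
for all `E ∈ 𝒢`, i.e. `|P[A | 𝒢] − u| ≤ bound` a.s. on `W`. [folklore] -/
def TailEssSup (a₀ θ₀ σ ρ : ℝ) (bound : ℝ) : Prop :=
  ∀ τ : ℝ, 0 < τ → ∀ n : ℕ, ∃ N₀ : ℕ, ∀ N : ℕ, N₀ ≤ N →
    ∀ Φ : HardSphereFlow (Torus.geometry (Fin 3)) (hsDiameter σ N) (N + 1),
    ∀ (i : Fin (N + 1)) (B : Set V3), MeasurableSet B →
    ∀ E : Set (Config (N + 1) (Fin 3) T3), MeasurableSet[pastSigma σ ρ n N Φ i] E →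
      defect a₀ θ₀ σ τ n N Φ i B E ≤ bound *
        ((localGibbsLaw σ (fun _ => a₀) (fun _ => 0) (fun _ => θ₀) N Φ)
          ({z | n + 1 ≤ Set.ncard (collisionTimesOf (Torus.geometry (Fin 3)) (hsDiameter σ N)
              (fun t => Φ.flow t z) i ∩ Set.Ioc 0 (τ * ((N + 1 : ℕ) : ℝ) ^ (-(1 / 3 : ℝ))))} ∩ E)).toReal

/-- **Any proof must use the AVERAGED form** (near-miss, not closed): the ess-sup strengthening is FALSE.
Witness event (3-ring): `E₃ = {j's previous partner = i's previous partner =: k; i, j, k otherwise free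
on (s_j, t_n)}` — `𝒢`-measurable up to null sets (velocity changes between the two snapshots identify
the colliding pairs). On `E₃`: `ω_{ik}` is known exactly (pre AND post velocities of `(i,k)` are in `𝒢`),
`x_k(s_i) − x_k(s_j) = Δs·v_k` with `Δs` exactly inferable (LLN over spectators), so
`b = Π_⊥(ε ω_{ik} + ε ω_{kj} + known)` with only `ω_{kj}` unknown, flux-distributed on a hemisphere ⇒ the
conditional law of `ĝ_out` is `O(1)`-far from uniform (TV 0.22–0.52, CRUX-ATTACK-9688-g3 numerics) while
`P(E₃ ∩ W) ≍ ε/ℓ ≍ σ³ > 0`. Hence `sup` over `E ⊆ E₃` of defect/P(W∩E) stays `O(1)` as `σ → 0`.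
OBSTRUCTION: quantitative ring-event lower bound `P(E₃ ∩ W) > 0` (indeed `≍ σ³`) under Gibbs + flow
bookkeeping. [folklore] -/
theorem not_tailEssSup : ¬ ∀ θ₀ : ℝ, 0 < θ₀ → ∃ C : ℝ, 0 < C ∧ ∃ p : ℝ, 0 < p ∧ ∃ σ₀ : ℝ, 0 < σ₀ ∧
    ∀ σ : ℝ, 0 < σ → σ < σ₀ → ∃ ρ : ℝ, σ ≤ ρ ∧ ρ * (Real.sqrt 2 * Real.pi * σ ^ 2) ≤ 1 ∧
      TailEssSup 1 θ₀ σ ρ (C * σ ^ p) := by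
  sorry

/-! ## §4 Tightness: the exponent cannot exceed `3` -/

/-- **Exponent floor `p ≤ 3`** (near-miss, not closed): the crux with `σ^p`, `p > 3`, is FALSE. Two
independent `N`-uniform floors, both `≍ σ³` at the prover-optimal `ρ = (√2πσ²)⁻¹` and larger otherwise:
(i) CELL-GRADIENT LEAK — given `𝒢`, `b = Π_⊥(x_k(s_j) − x_j(s_j)) + (𝒢-measurable vector)` on the
`O(1)`-mass event {`i` and its previous partner `k` free between the snapshots}; the conditional density
of a difference of two points uniform in `r`-cells is Lipschitz at scale `r`, so its restriction to the
`ε`-disc has relative oscillation `≍ ε/r = σ/ρ ≥ √2π σ³`, realised in `L¹(𝒢)` (sup over `E`)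
(the cell-boundary THIN-BOX events — both boxes `C₁ ∩ (C₀ + Δs·v)` of `i` and of `j` `ε`-thin in a common
direction, probability `≍ (ε/r)²` — pin one component of `b` outright but are subdominant);
(ii) 3-RING LEAK — `O(1)` conditional bias on mass `≍ ε/ℓ = √2π σ³` (`not_tailEssSup`).
So `sup_E defect ≳ σ³` for every admissible `ρ`, every large `τ`, uniformly in `N ≥ N₀`; with `p > 3`
and `σ → 0` the inequality fails. The card's heuristic `p = 3/2` (`r ≍ (εℓ)^{1/2}`) and any `p ≤ 3` are
NOT excluded. OBSTRUCTION: as in §3 (lower bounds on many-body collision statistics under Gibbs).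
[folklore] -/
theorem not_body_exponent_gt_three : ¬ ∀ θ₀ : ℝ, 0 < θ₀ → ∃ C : ℝ, 0 < C ∧ ∃ p : ℝ, 3 < p ∧
    ∃ σ₀ : ℝ, 0 < σ₀ ∧ ∀ σ : ℝ, 0 < σ → σ < σ₀ →
      ∃ ρ : ℝ, σ ≤ ρ ∧ ρ * (Real.sqrt 2 * Real.pi * σ ^ 2) ≤ 1 ∧ Tail 1 θ₀ σ ρ (C * σ ^ p) := by
  sorry

/-! ## §5 Targets (lead's stuck stubs)

Cycle 1: `payload.stuck_stubs = []`. Since then line `Sketch` was picked (PICKED.md, 10:31Z): its composition is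
`OneFlightLayeredChaos_proof := oneFlightLayeredChaos_iff_one.2 stub_body_one` (this file's §2 reduction), and the lead
reshaped `stub_body_one` into bookkeeping stubs ∘ `stub_core` (conditional flux law of the impact vector given `𝒢`, kernel
form). The bookkeeping stubs (contact record on `good ∩ W`; recorded incoming velocities = flight-start velocities ∈ `𝒢`;
flux measure ↦ ¼·surface measure in `d = 3`) are true kinematics — not targets. `stub_core` = the crux's content; its only
known attack is the rigid-regime inverse problem of §6 (header). -/

/-! ## §6 Regimes checked and found harmless (no theorem needed; recorded for the provers)

* junk of `Φ.flow` off `Φ.good`: invisible — only `P`-measures of sets occur and `P ≪ liouville`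
  (`localGibbsMeasure_absolutelyContinuous`), `P(goodᶜ) = 0`; a `𝒢`-set built from junk differs from a
  Borel set inside a null set only (outer measure unchanged). Negative 11470's pattern does not bite.
* `B ⊄ S²`: `u` only sees `B ∩ S²` and `outDir ∈ S²` on `W ∩ good` (`norm_outDir`, partners differ and
  `v_i⁺ ≠ v_j⁺` since the pair was incoming); `B = ∅ / ⊇ S²` give defect `0`.
* `τ → 0`: `P(W) ≍ (σ²τ)^{n+1} → 0`, trivial by `defect_le_measure`; `τ → ∞`, `n → ∞`: stationarity of
  the equilibrium dynamics, content kept, no new leak.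
* `N = 0` (one sphere): `W = ∅`. Small `N ≥ 1`: excluded by `N₀(σ, ρ, τ, n)`.
* `ρ`-range: restricting an `∃`-witness only; dropping either bound weakens the crux (cannot create
  falsity). Coarse-graining the velocities too (planner's fallback) likewise weakens it.
* `θ₀`: scales out (`v ↦ √θ₀ v`, `t ↦ t/√θ₀`, `τ ↦ τ/√θ₀`, `∀ τ`), so `C, p, σ₀` may be taken
  independent of `(a₀, θ₀)` — informal (no flow-rescaling equivalence in the tree).
-/

/-! ## §8a (gen 2, proved) Formal backbone of N4: the IPR identity

For a finite measure `μ`, a sub-σ-algebra `m` (the data `𝒢`) and a class `C` (an itinerary piece):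
`∫ 1_C · μ[1_C | m] dμ = ∫ (μ[1_C | m])² dμ`; summed over a finite family of classes partitioning the space, the
mean posterior weight of the TRUE class equals the mean inverse participation ratio `E[Σ_c w_c²]` of the class
posterior. Hence "the truth's class carries negligible posterior weight" (lead D2(c)) and "the posterior condenses on
few classes" (what a pinning kill needs) are NEGATIONS of each other — the dichotomy of §6 in one line. -/

/-- **IPR identity, one class**: `∫ 1_C · μ[1_C|m] = ∫ (μ[1_C|m])²` (pull the `m`-measurable factor `μ[1_C|m]`
out of the conditional expectation and integrate). [folklore] -/
theorem integral_indicator_mul_condExp_eq_sq {Ω : Type*} {m m0 : MeasurableSpace Ω} {μ : Measure Ω}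
    (hm : m ≤ m0) [IsFiniteMeasure μ] {C : Set Ω} (hC : MeasurableSet C) :
    ∫ x, C.indicator (fun _ => (1 : ℝ)) x * (μ[C.indicator (fun _ => (1 : ℝ))|m]) x ∂μ =
      ∫ x, (μ[C.indicator (fun _ => (1 : ℝ))|m]) x ^ 2 ∂μ := by
  set g : Ω → ℝ := C.indicator (fun _ => (1 : ℝ)) with hgdef
  have hg : Integrable g μ := (integrable_const (1 : ℝ)).indicator hC
  have hbdd : ∀ᵐ x ∂μ, |g x| ≤ (1 : ℝ) := Eventually.of_forall fun x => by
    by_cases hx : x ∈ C <;> simp [hgdef, hx]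
  have hcbdd : ∀ᵐ x ∂μ, |(μ[g|m]) x| ≤ (1 : ℝ) := ae_bdd_abs_condExp_of_ae_bdd_abs hbdd
  have hint : Integrable (fun x => (μ[g|m]) x * g x) μ := by
    refine hg.bdd_mul (c := 1) (stronglyMeasurable_condExp.mono hm).aestronglyMeasurable ?_
    exact hcbdd.mono fun x hx => by simpa [Real.norm_eq_abs] using hx
  have hpull : μ[(fun x => (μ[g|m]) x * g x)|m] =ᵐ[μ] fun x => (μ[g|m]) x * (μ[g|m]) x :=
    condExp_mul_of_stronglyMeasurable_left stronglyMeasurable_condExp hint hg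
  calc ∫ x, g x * (μ[g|m]) x ∂μ = ∫ x, (μ[g|m]) x * g x ∂μ := by simp_rw [mul_comm]
    _ = ∫ x, (μ[(fun x => (μ[g|m]) x * g x)|m]) x ∂μ := (integral_condExp hm).symm
    _ = ∫ x, (μ[g|m]) x * (μ[g|m]) x ∂μ := integral_congr_ae hpull
    _ = ∫ x, (μ[g|m]) x ^ 2 ∂μ := by simp_rw [sq]

/-- **IPR identity, a finite family of classes** (a partition into itinerary pieces): `Σ_c ∫ 1_{C_c} μ[1_{C_c}|m]`
(mean posterior weight of the class one is in) `= Σ_c ∫ (μ[1_{C_c}|m])²` (mean inverse participation ratio).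
[folklore] -/
theorem ipr_identity {Ω ι : Type*} [Fintype ι] {m m0 : MeasurableSpace Ω} {μ : Measure Ω}
    (hm : m ≤ m0) [IsFiniteMeasure μ] (C : ι → Set Ω) (hC : ∀ c, MeasurableSet (C c)) :
    ∑ c, ∫ x, (C c).indicator (fun _ => (1 : ℝ)) x * (μ[(C c).indicator (fun _ => (1 : ℝ))|m]) x ∂μ =
      ∑ c, ∫ x, (μ[(C c).indicator (fun _ => (1 : ℝ))|m]) x ^ 2 ∂μ :=
  Finset.sum_congr rfl fun c _ => integral_indicator_mul_condExp_eq_sq hm (hC c)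

/-! ## §8 (gen 2) Why the crux resists: the long-gap regime re-analysed (informal; N1–N7)

Notation: `e` = the EARLY particle of `{i, j}` (flight start `s = min(s_i, s_j)`), `L` = the late one (flight start
`s' = max`), `Δs = s' − s` (known to precision `≍ r/(v N)` from the spectators' two cells — a HARD constraint, an
intersection of `N` intervals, not a CLT); `l` = `e`'s previous partner (in contact with `e` at `s`), `k` = `L`'s
previous partner (contact at `s'`); `b = Π_{⊥g}(x_e(s') − x_L(s'))`, `g = v_e − v_L` (exact, in `𝒢`); "core" = the
rigid (mean degree ≥ 3) part of the inter-snapshot collision graph on the long-gap event `R = {Δs ≳ u* t_mf}`,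
`P(R) ≍ e^{−u*}` `σ`-FREE; "root"/"class" = a point / an itinerary piece of the exact two-snapshot fibre.

* N1 LONGITUDINAL SMEARING (`n = 0` is safe). If `e` is NOT anchored by a contact at `s` — exactly the case `n = 0`
  (`e = i`, `s = s_i = 0`) — then `x_e(s)` is uniform (hard core aside) on the two-cell box `B_e = C_e(s) ∩ (C_e(s') − Δs v_e)`,
  of random sides `≤ r`, fat (`≫ ε` in all three directions) off an event of mass `≍ ε/r`. Against a FULLY PINNED AND
  KNOWN environment (worst case) each would-be shadower `m` of `e`'s flight does NOT cut a lune at a definite place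
  of the `b`-disc (lead NOTES D2(e)): `e` hits `m` iff `Π_{⊥(v_e−v_m)}(δ − δ_m) ∈ ε`-disc, a cylinder in the 3-D offset
  `δ ∈ B_e` whose axis is NOT parallel to the target cylinder's (`⊥ g`); the two meet in volume `≍ ε³/sin∠` out of
  `≍ ε² r`, and projected along `g` the depletion is spread over the strip `|(b − δ_m)·n̂| < ε`, `n̂ ∝ g × (v_e − v_m)`,
  with RELATIVE amplitude `≍ ε/(r sin∠)` (the longitudinal offset of `e` = its timing sweeps `m`'s shadow across and
  off the disc). Shadowers whose strip meets the disc number `≍ (N+1) ε r² = (2π²σ³)⁻¹` at `r = ℓ` (≈ 50 at `σ = 0.1`),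
  signs/positions random ⇒ RMS modulation `≍ (2π²σ³)^{-1/2} · √2πσ³ ≍ 2 σ^{3/2}` — the card's `p = 3/2` recovered as
  the worst case of a KNOWN environment; with the environment itself posterior-diffuse (N5) it averages further.
  So the `n = 0` instance of the crux is polynomially true on this analysis; thin boxes cost `ε/r`.
  TOY CHECK (`smear_toy.py`, pure stdlib, in-session 46 s; full batch = kit j019569, queued): early particle aimed at a
  static target through a PINNED, KNOWN, MOVING stationary shadower cloud (density `0.01 ε⁻³`, speeds `0.7√3`, blocked
  fraction ≈ 0.3), start released at a time uniform on `[0, Λ]` (`Λ = r/ε`; lengths in `ε`, speed 1); conditional law of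
  `b` on the unit disc over 8 environments × 5000 accepted starts, 32 equal-area polar bins (same-`n` uniform baseline
  TV ≈ 0.032): mean TV32 = 0.276 / 0.259 / 0.176 / 0.123 / 0.071 / 0.038 and dipole `|E b|` = 0.246 / 0.215 / 0.153 /
  0.113 / 0.062 / 0.022 at `Λ` = 0 / 1 / 3 / 10 / 30 / 100 (worst environment 0.88 at `Λ = 0`, 0.057 at `Λ = 100`):
  the lunes of a known environment ARE `O(1)` at pinned timing and wash out like `Λ^{-1/2}` (baseline-corrected
  0.173 → 0.062 → 0.02 for `Λ` = 3 → 30 → 100); the gas value is `Λ = ℓ/ε = (√2πσ³)⁻¹` = 225 at `σ = 0.1`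
  (extrapolated excess TV ≈ 0.02) and 1800 at `σ = 0.05` (≈ 0.007) — `∝ σ^{3/2}` as claimed. Residual structure at
  moderate `Λ` is carried by slow-transverse ("lingering") shadowers, an event of frequency `∝ (ε/(vT))²` per visitor,
  i.e. `≍ σ³` in the gas — polynomial again.
* N2 ATTACK SURFACE. A `σ`-free `O(1)` bias needs `x_e(s)` pinned at scale `≲ ε` in BOTH transverse and longitudinal
  directions, i.e. `e` anchored by its contact at `s`: `x_e(s) = x_l(s) + εΩ`, `Ω` cosine-distributed on the
  outgoing hemisphere of `ĝ⁺_{el}` (pre-velocities at `s⁻` are not in `𝒢`; equilibrium collision law in post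
  variables), AND `l` pinned relative to `k` at scale `≪ ε` by the data ⇒ `l, k ∈ core` (a once-colliding `k` is a
  boxed spectator: safe). Then per root `b ∈ 1_{|b|≤ε} · bump(b − Π_⊥ c_root)`, `O(1)` non-uniform. Cases: `n ≥ 1`
  with `e = i` (`l` = `i`'s `(n−1)`-th partner, whose identity is NOT in `𝒢`), or `e = j` with `s_j > 0`. Mass of the
  bad event `≍ e^{−u*} · P(l, k ∈ core | R) ≈ 1–3 %`, `σ`-free. Everything hinges on the posterior law of `Π_⊥ c`.
* N3 COMPONENT PARTITION IS DATA. Momentum and energy are conserved per connected component of the inter-snapshot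
  collision graph; a finer accidental conservation has probability `0`, so the finest conserving partition of the
  collider set is the TRUE component partition, `𝒢`-measurable a.s.; by the singular-support argument (lead D2(b),
  run in the other direction) posterior classes have EXACTLY that partition (a merging class has a higher-dimensional
  image and charges the data surface with density `0`). Small components (dimers: pair AND normal decoded from
  `Δv_k = −Δv_l`, one free clock; small trees) are decoded but floppy — harmless; the content sits in the giant
  component (fraction `≈ 1 − e^{−u·θ}` of the colliders).
* N4 IPR IDENTITY. `E[posterior weight of the truth's class] = E[Σ_c w_c(V)²]` (average inverse participation ratio
  of the class posterior): "the truth carries weight `e^{−Θ(N)}`" (lead D2(c)) ⟺ NO CONDENSATION (exponentially many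
  classes share the posterior) and "global pinning" (the kill) ⟺ CONDENSATION. So the crux on `R` is a freezing
  question for a random-energy-type measure: `e^{S}` admissible classes, log-weights fluctuating by `W`. Crude REM
  numbers: `S ≳ (3M−4) log(r/ε) + 2(E−M) log(ℓ/ε)` (coarea), `W ≈ 2·1.28·√E'` (CLT over flights, std of log of an
  exponential flight = 1.28) ⇒ `W/√(2S) ≈ 1.1/√(log(ℓ/ε)) < 1` iff `ℓ/ε > 3.3` iff `σ < 0.41`: high-temperature
  (spread) phase throughout the dilute regime.
* N4′ IDEALISED IPR FORMULA. Model: classes `c` of prior mass `π₁`, pieces of volume `vol₁ = π₁/π_dens`, image volume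
  `J·vol₁` in a velocity region of volume `V`, uniform density on the image, `v` hit by a class with probability
  `min(1, J vol₁/V)`. Then the TOTAL weight of a class type is `∝` its prior mass whatever `J` (the `1/J` of a root
  cancels against the hitting probability / multiplicity — N5), but `Σ w_c²` is not: non-wrapping types contribute
  `∝ π_type/J_type`, wrapping types `∝ π_type²/K_type`. With the 4 gauge directions (root = orbit of volume `≍ r³ℓ`):
  `IPR ≈ (ℓ/r)(ε/r)^{3M−4} · E_prior[Λ_extra⁻¹]` on the rigid event, `Λ_extra = Π_{non-first collisions}(ℓ_f/ε)² ≥ 1`.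
  The expectation IS dominated by compact short-flight configurations (the lead's D2(d) tilt, correctly placed: a
  large-deviation enhancement from the typical `(ε/ℓ)^{2(E−M)}` to `≈ (ε/ℓ)^{E−M}`), yet `IPR ≲ (ε/r)^{3M−4} ≪ 1`:
  NO condensation as long as the cells are much wider than `ε`; condensation (pinning) only as `r ↓ ε`, i.e. at the
  disprover-irrelevant end `ρ ≈ σ` of the mesh range. This is the quantitative reason the prover's `ρ⋆` is safe.
* N5 CLASS WEIGHTS ≈ PRIOR × BOUNDED LIKELIHOOD. For a class `c` whose image wraps the velocity region many times
  (huge `J`), `p_c(v) = Σ_{roots∈c} π/J ≈ π(c) · g_c(v)` with `g_c` the normalised push-forward (an `O(1)`-scale density):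
  the `1/J` tilt that favours short flights (lead D2(d)) CANCELS against root multiplicity at class level and only
  re-weights roots inside a class. Hence `log(w_c/w_{c*}) ≈ log(π(c)/π(c*)) − KL-type mismatch`, the mismatch being
  `β = O(1)` nats per RE-PAIRED particle (final-velocity laws of dense itineraries are 3-D spread at thermal scale;
  single-collision re-pairing is impossible — codimension 1 — so re-pairings are dense, as in lead D2(c)). And
  `E_data[posterior] = prior` forbids the posterior of typical data to sit on prior-atypical (compact, low-`J`)
  configurations: dominant classes look like ordinary gas histories.
* N6 THE LOCAL BUDGET IS `σ`-INDEPENDENT PER SLOT, ABUNDANT FROM TWO SLOTS. Equidistribution of `Π_⊥c` mod `ε` over a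
  region of size `r = ℓ` needs `≫ (ℓ/ε)² = (2π²σ⁶)⁻¹` distinct well-weighted values. Re-pairing ONE collision slot of
  `l` (or `k`) offers `≈ 27ρ³ = 27(ℓ/ε)³σ³ = 0.31 σ⁻⁶` alternative partners (particles in the 27 cells around the
  contact), each costing `e^{−β}`: ratio `≈ 6 e^{−β}` — `σ`-FREE and marginal for one slot; but `l` and `k` carry
  `≈ 2u ≈ 6–8` slots combining multiplicatively, `(0.31σ⁻⁶e^{−β})^s ≫ σ⁻⁶` for `s ≥ 2` as soon as
  `σ⁶ ≪ 0.31e^{−β}` (`σ ≲ 0.6 e^{−β/6}`). Far re-pairings add more if the marginally-rigid network's response to a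
  distant rewiring is long-ranged (isostatic networks: plausible, unquantified). CONCLUSION: at small `σ` the
  posterior marginal of `Π_⊥c` is `ε`-equidistributed with a huge margin (heuristically), the rigid event contributes
  `≲ P(R)·(ε/ℓ)²e^{β}` to the defect, and the floppy-regime floors of §4 dominate: conjectured SHARP EXPONENT `p = 3`
  (defect `≍ σ³|log σ|`: rings + cell-gradient leak), not the card's `3/2`. A kill along N2 would need either
  `σ` NOT small (possible condensation for `σ³ ≳ 0.1`, outside `∃σ₀`) or a correlation mechanism making the
  per-particle likelihood cost grow like `log(ℓ/ε)` — none found. What a PROOF of `stub_dust` should therefore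
  formalise is not hyperbolic mixing along unstable manifolds but ABUNDANCE OF DATA-PRESERVING LOCAL RE-PAIRINGS
  (a resampling / "many histories" argument on the exact fibre with controlled Jacobians).
* N7 LINE `Sketch` (payload line; stubs `stub_floppy` ∃u₀, `stub_dust` ∀u₀ at mesh `ρ⋆`, composition proved;
  lead-1's kinematic layer `stub_core`): no stub is false for a cheap reason; joint sufficiency is a theorem
  (`regimeBody_univ_of_split`), no smuggled gap. Remarks: (a) `∃u₀` lets `u₀ → 0`, where `shortGap ∩ W` keeps `O(1)`
  mass only through the one-snapshot atom `{n = 0, s_j = 0}` (safe by N1) and exact ties `s_i = s_j` (mutual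
  recollision, `σ³`) — so `stub_floppy` at tiny `u₀` is nearly the one-snapshot statement plus a sliver, and the
  whole two-snapshot content migrates into `stub_dust` (∀u₀): the split is honest but puts everything hard on one
  side whatever `u₀` the floppy prover picks; (b) `mfTime` exceeds the kinetic mean free time by the factor
  `√2π·⟨|v_rel|⟩/√θ₀ ≈ 10`, absorbed by the quantifiers; (c) §2b(iii): a refutation of `stub_dust` at `ρ⋆` refutes
  the crux along `ρ⋆/ℕ` only (formally). No `stuck_stubs` were handed over (payload `targets = []`).
-/

end

end Summit.AtomisticToContinuum.HydrodynamicLimit.Cruxes.OneFlightLayeredChaos.Disproof
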